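import Summits.QuantumFields.BalabanUV.Beta.GAN24.ContactTentCauchy
import Summits.QuantumFields.BalabanUV.Beta.GAN24.StaircaseFaces
import Summits.QuantumFields.BalabanUV.Beta.GAN24.RespStepCauchy
import Summits.QuantumFields.BalabanUV.Beta.GAN24.TaylorLamVertexPairing

/-!
# `BalabanUV.Beta.GAN24.ContactTentRefine` — binder row G-an2-4 ∕ (CONV-C), the row owner's CONTACT-TERM ROUTE, `gen19/CT4-DESIGN-v0.md` §2 (γ), SECOND HALF:
# **THE TENT FORCE OF THE TALLER TOWER AT A FINE′ SITE AGAINST THE SHORTER TOWER's TENT FORCE AT ITS CELL — POINTWISE, `O(θ_K^k + 1∕N)` RELATIVE**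
# («the tent structure carries the difference to `t′` … vs `t(c)`: `≤ C(θ_K^n + Lc∕N)` relative» — here `1∕N`, and pointwise in the fine′ site, so that CT-4c's
# cell sum is one line)

NOT IN PRINT; OUR PROOF ATTEMPT (unit `b2b-balaban-gan24-p2`, gen 32 = prover-b2b-balaban-gan24-p2-g32-0, road-P2 chair of row G-an2-4; CRUX TEAM (2) under the
ruling «YM REDIRECT TOWARDS THE SUMMIT», 2026-08-21; INTENT «TENT-REFINE» journal `CLAIMS.log` l.33674).  HONEST FRAMING (cell contract, verbatim): «discharging
`BetaPertH` makes Bałaban's UV stability UNCONDITIONAL — a real constructive-QFT result; it is NOT the continuum limit and NOT the Clay problem.»  HONEST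
DEPENDENCY (verbatim): «continuum YM on T⁴ ⇐ BetaPertH ∧ nine spine estimates (0/9 proved); BetaPertH ⇐ (D1) ∧ (D4) ∧ CAP+tail; G-an2-4 gates asym, D1 and
NE2/3/4.»  ABSOLUTE RULE: nothing printed is a hypothesis; no `def … : Prop`, no `sorry`, 0 `def`; [folklore] lattice bookkeeping BY NAME over the owner's
`StaircaseFaces` ((F4) `abs_contourSumAdj_add_unitVec_sub_le`, `supNorm_unitVec_le_one`), road S3's `TaylorLamVertexPairing.contourSumAdj_mul` (`𝒬ᵀ_{LN} = 𝒬ᵀ_L ∘ 𝒬ᵀ_N`),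
an5's `KKTFluctuationEnergy.contourSumAdj_eq`, the owner's `RespStepCauchy.supNorm_le_l1`, and MY `ContactTentCauchy.exists_unitTent_letters_three` (p289648).

## Mechanism
`𝒬ᵀ_{LN} = 𝒬ᵀ_L ∘ 𝒬ᵀ_N`: the taller tower's normalised tent `(LN)⁻¹𝒬ᵀ_{LN}φ′` at a fine′ site `x` is the AVERAGE over `t < L` of the shorter-lattice tents
`N⁻¹𝒬ᵀ_Nφ′` at the `L`-block labels `quo L (x − t e_κ)`, which take only the two values `c = quo L x` and `c − e_κ` (§1).  Against `N⁻¹𝒬ᵀ_Nφ (c)`: the KERNEL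
difference `φ′ − φ` costs `ε` (`N` summands × `N⁻¹`, §2), the LABEL wobble costs ONE (F4) step — a COARSE difference of `φ` with NO factor `N` — times `N⁻¹`.

## Content (0 sorry, 0 def)
 * §1 `quo_sub_natSmul_unitVec_eq_or` (`s ≤ N`: `quo N (x − s e_κ) = quo N x ∨ = quo N x − e_κ`), `supNorm_quo_sub_le_succ` (the label of `x − s e_κ` is within `1`
   of the label of `x`, any centre).
 * §2 `abs_contourSumAdj_le_centre` (d4-p3's `abs_contourSumAdj_le` with an arbitrary envelope centre: `|𝒬ᵀ_Nφ κ x| ≤ N·B·e^{κ₀}·e^{−κ₀‖quo N x − y₀‖∞}`),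
   `contourSumAdj_sub` (linearity).
 * §3 **`ntent_refine_sub_le`** (ABSTRACT; every `N, L ≥ 1`, `N′ = L·N`): envelopes `|φ κ y| ≤ Φ₀e^{−κ₀‖y−y₀‖∞}`, `|φ′ κ y − φ κ y| ≤ εe^{−κ₀‖y−y₀‖∞}` give, for
   every κ and fine′ site x, `|N′⁻¹·𝒬ᵀ_{N′}φ′ κ x − N⁻¹·𝒬ᵀ_Nφ κ (quo L x)| ≤ (ε·e^{2κ₀} + 2Φ₀e^{3κ₀}∕N)·e^{−κ₀‖quo N (quo L x) − y₀‖∞}`.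
 * §4 **`exists_tent_refine_three`** (`d = 3`, `Lc ≥ 2`, UNCONDITIONAL via my `exists_unitTent_letters_three`) and its ALL-SCALES twin
   **`exists_tent_refine_all_three`** (towers `k+j` vs `k`, `L = Lc^j`, the SAME constants for all `k, j` — no sum over intermediate towers): with the unit tents
   `Φ^{(k)}_{μ,z} κ y := (Lc^{k+1})^8·wΦ_{Lc^{k+1}} κ μ (y − z)` of `ContactPartnerLetters`∕`ContactTentCauchy`,
   `∃ A B δ θ, 0 < δ ∧ 0 ≤ θ < 1 ∧ ∀ k μ z κ x, |(Lc^{k+2})⁻¹·𝒬ᵀ_{Lc^{k+2}}Φ^{(k+1)}_{μ,z} κ x − (Lc^{k+1})⁻¹·𝒬ᵀ_{Lc^{k+1}}Φ^{(k)}_{μ,z} κ (quo Lc x)|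
   ≤ (A·θ^k + B·((Lc^{k+1})⁻¹))·e^{−δ‖quo (Lc^{k+1}) (quo Lc x) − z‖∞}` — consecutive towers, tower `k+1`'s tent force read at a fine′ site against tower `k`'s at its
   `Lc`-cell, relative `O(θ^k + 1∕N_k)`.
HONEST.  [folklore]; discharges NOTHING of (hS, hSall, hSdev) on (E); NOT CT-4c's cell SUM (one line from §3∕§4), NOT CT-4b∕CT-4e; ‖·‖∞ currency on the labels (the unit
tents' ℓ¹ letters weakened by `supNorm_le_l1`); the native weights `(Lc^{8(k+1)})⁻¹` of `ContactPartnerLetters` are one `unitTent_eq` away; NEVER «G-an2-4 closed»;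
NOT (CONV-C) as typed, NOT D1, NOT BetaPertH, NOT continuum, NOT Clay.  Text locations only: [King1986] §4 p. 672 (the Leibniz∕refinement pattern); [Balaban1987RG1] (1.20)–(1.22) p. 264.
-/

noncomputable section

open Finset
open scoped BigOperators
open Literature.MathematicalPhysics.QuantumFieldTheory
open Literature.MathematicalPhysics.QuantumFieldTheory.LatticeForm (quo)
open Literature.MathematicalPhysics.QuantumFieldTheory.Balaban1983to89
open Literature.MathematicalPhysics.QuantumFieldTheory.Balaban1983to89.Beta
open B4ContourShift (supNorm abs_le_supNorm supNorm_nonneg)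
open B4Reflection242 (supNorm_le_of_forall supNorm_add_le)
open B12Sec2to5 (l1 l1_nonneg)
open AffineAveraging (Form1 Site unitVec unitVec_apply)
open AffineReproduction (contourSumAdj)
open KernelSpecInstance (wΦ)
open KKTFluctuationEnergy (contourSumAdj_eq)
open Summit.QuantumFields.BalabanUV.Beta.GAN24.StaircaseFaces (abs_contourSumAdj_add_unitVec_sub_le supNorm_unitVec_le_one)
open Summit.QuantumFields.BalabanUV.Beta.GAN24.TaylorLamVertexPairing (contourSumAdj_mul)
open Summit.QuantumFields.BalabanUV.Beta.GAN24.RespStepCauchy (supNorm_le_l1)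
open Summit.QuantumFields.BalabanUV.Beta.GAN24.ContactTentCauchy (exists_unitTent_letters_three)

namespace Summit.QuantumFields.BalabanUV.Beta.GAN24.ContactTentRefine

variable {d : ℕ}

/-! ## §1 The labels along one contour take two values -/

section Labels

variable {N : ℕ} [NeZero N]

/-- **ALONG A CONTOUR OF LENGTH `≤ N` THE BLOCK LABEL TAKES TWO VALUES**: for `s ≤ N`, `quo N (x − s·e_κ)` is `quo N x` or `quo N x − e_κ`. [folklore] -/
theorem quo_sub_natSmul_unitVec_eq_or {s : ℕ} (hs : s ≤ N) (x : Site (d + 1)) (κ : Fin (d + 1)) :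
    quo N (x - (s : ℤ) • unitVec κ) = quo N x ∨ quo N (x - (s : ℤ) • unitVec κ) = quo N x - unitVec κ := by
  have hN : (0 : ℤ) < (N : ℤ) := by exact_mod_cast Nat.pos_of_ne_zero (NeZero.ne N)
  have hsN : (s : ℤ) ≤ (N : ℤ) := by exact_mod_cast hs
  have hs0 : (0 : ℤ) ≤ (s : ℤ) := by exact_mod_cast Nat.zero_le s
  -- the `κ`-coordinate of the label moves down by at most one
  have hup : (x κ - (s : ℤ)) / (N : ℤ) ≤ x κ / (N : ℤ) := Int.ediv_le_ediv hN (by linarith)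
  have hdown : x κ / (N : ℤ) - 1 ≤ (x κ - (s : ℤ)) / (N : ℤ) := by
    have e : x κ / (N : ℤ) - 1 = (x κ + (-1) * (N : ℤ)) / (N : ℤ) := by rw [Int.add_mul_ediv_right _ _ hN.ne']; ring
    rw [e]
    exact Int.ediv_le_ediv hN (by linarith)
  have hoff : ∀ j, j ≠ κ → quo N (x - (s : ℤ) • unitVec κ) j = quo N x j := fun j hj => by
    simp only [quo, Pi.sub_apply, Pi.smul_apply, unitVec_apply, if_neg hj, smul_eq_mul, mul_zero, sub_zero]
  have hon : quo N (x - (s : ℤ) • unitVec κ) κ = (x κ - (s : ℤ)) / (N : ℤ) := by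
    simp only [quo, Pi.sub_apply, Pi.smul_apply, unitVec_apply, if_true, smul_eq_mul, mul_one]
  rcases (show (x κ - (s : ℤ)) / (N : ℤ) = x κ / (N : ℤ) ∨ (x κ - (s : ℤ)) / (N : ℤ) = x κ / (N : ℤ) - 1 by omega) with h | h
  · left
    funext j
    by_cases hj : j = κ
    · subst hj; rw [hon, h]; rfl
    · exact hoff j hj
  · right
    funext j
    by_cases hj : j = κ
    · subst hj
      rw [hon, h, Pi.sub_apply, unitVec_apply, if_pos rfl]
      rfl
    · rw [hoff j hj, Pi.sub_apply, unitVec_apply, if_neg hj, sub_zero]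

/-- the label of `x − s·e_κ` (`s ≤ N`) is within sup-distance `1` of the label of `x`, seen from any centre `y₀`:
`‖quo N x − y₀‖∞ ≤ ‖quo N (x − s·e_κ) − y₀‖∞ + 1`. [folklore] -/
theorem supNorm_quo_sub_le_succ {s : ℕ} (hs : s ≤ N) (x y₀ : Site (d + 1)) (κ : Fin (d + 1)) :
    supNorm (quo N x - y₀) ≤ supNorm (quo N (x - (s : ℤ) • unitVec κ) - y₀) + 1 := by
  rcases quo_sub_natSmul_unitVec_eq_or hs x κ with h | h
  · rw [h]; linarith
  · rw [h]
    have e : quo N x - y₀ = (quo N x - unitVec κ - y₀) + unitVec κ := by abel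
    rw [e]
    exact (supNorm_add_le _ _).trans (by linarith [supNorm_unitVec_le_one (d := d) κ])

end Labels

/-! ## §2 The tent of a kernel with a centred envelope; linearity -/

section Tent

variable {N : ℕ} [NeZero N]

/-- **THE TENT OF A COARSE 1-FORM WITH A CENTRED ENVELOPE**: `|φ κ y| ≤ B·e^{−κ₀‖y − y₀‖∞}` (`B, κ₀ ≥ 0`) gives
`|𝒬ᵀ_Nφ κ x| ≤ N·B·e^{κ₀}·e^{−κ₀‖quo N x − y₀‖∞}` (d4-p3's `RemainderExplicitLaplacian.abs_contourSumAdj_le` is the case `y₀ = 0`). [folklore] -/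
theorem abs_contourSumAdj_le_centre {φ : Form1 (d + 1) ℝ} {B κ₀ : ℝ} (hB : 0 ≤ B) (hκ : 0 ≤ κ₀) (y₀ : Site (d + 1))
    (hφ : ∀ κ y, |φ κ y| ≤ B * Real.exp (-(κ₀ * supNorm (y - y₀)))) (κ : Fin (d + 1)) (x : Site (d + 1)) :
    |contourSumAdj N φ κ x| ≤ (N : ℝ) * B * Real.exp κ₀ * Real.exp (-(κ₀ * supNorm (quo N x - y₀))) := by
  rw [contourSumAdj_eq]
  have hterm : ∀ s ∈ Finset.range N,
      |φ κ (quo N (x - (s : ℤ) • unitVec κ))| ≤ B * Real.exp κ₀ * Real.exp (-(κ₀ * supNorm (quo N x - y₀))) := by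
    intro s hs
    have hsN : s ≤ N := (Finset.mem_range.mp hs).le
    refine (hφ κ _).trans ?_
    rw [mul_assoc, ← Real.exp_add]
    refine mul_le_mul_of_nonneg_left (Real.exp_le_exp.mpr ?_) hB
    have h := supNorm_quo_sub_le_succ hsN x y₀ κ
    nlinarith
  calc |∑ s ∈ Finset.range N, φ κ (quo N (x - (s : ℤ) • unitVec κ))|
      ≤ ∑ s ∈ Finset.range N, |φ κ (quo N (x - (s : ℤ) • unitVec κ))| := Finset.abs_sum_le_sum_abs _ _
    _ ≤ ∑ _s ∈ Finset.range N, B * Real.exp κ₀ * Real.exp (-(κ₀ * supNorm (quo N x - y₀))) := Finset.sum_le_sum hterm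
    _ = _ := by rw [Finset.sum_const, Finset.card_range, nsmul_eq_mul]; ring

omit [NeZero N] in
/-- `𝒬ᵀ` is linear: `𝒬ᵀ_Nφ′ κ x − 𝒬ᵀ_Nφ κ x = 𝒬ᵀ_N(φ′ − φ) κ x`. [folklore] -/
theorem contourSumAdj_sub (φ' φ : Form1 (d + 1) ℝ) (κ : Fin (d + 1)) (x : Site (d + 1)) :
    contourSumAdj N φ' κ x - contourSumAdj N φ κ x = contourSumAdj N (fun l y => φ' l y - φ l y) κ x := by
  rw [contourSumAdj_eq, contourSumAdj_eq, contourSumAdj_eq, ← Finset.sum_sub_distrib]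

end Tent

/-! ## §3 The abstract tent refinement law -/

section Refine

variable {N N' L : ℕ} [NeZero N] [NeZero L]

/-- **THE TENT REFINEMENT LAW** (every `N, L ≥ 1`, `N′ = L·N`): for coarse 1-forms with `|φ κ y| ≤ Φ₀e^{−κ₀‖y−y₀‖∞}` and
`|φ′ κ y − φ κ y| ≤ εe^{−κ₀‖y−y₀‖∞}` (`Φ₀, ε, κ₀ ≥ 0`), every κ and every fine′ site x,
`|N′⁻¹·𝒬ᵀ_{N′}φ′ κ x − N⁻¹·𝒬ᵀ_Nφ κ (quo L x)| ≤ (ε·e^{2κ₀} + 2Φ₀e^{3κ₀}∕N)·e^{−κ₀‖quo N (quo L x) − y₀‖∞}`.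
[cite: King1986, §4 p.672 (refinement∕Leibniz pattern)] [folklore] -/
theorem ntent_refine_sub_le (hN' : N' = L * N) {φ φ' : Form1 (d + 1) ℝ} {Φ₀ ε κ₀ : ℝ} (hΦ : 0 ≤ Φ₀) (hε : 0 ≤ ε) (hκ : 0 ≤ κ₀)
    (y₀ : Site (d + 1)) (hφ : ∀ κ y, |φ κ y| ≤ Φ₀ * Real.exp (-(κ₀ * supNorm (y - y₀))))
    (hd : ∀ κ y, |φ' κ y - φ κ y| ≤ ε * Real.exp (-(κ₀ * supNorm (y - y₀)))) (κ : Fin (d + 1)) (x : Site (d + 1)) :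
    |((N' : ℕ) : ℝ)⁻¹ * contourSumAdj N' φ' κ x - ((N : ℕ) : ℝ)⁻¹ * contourSumAdj N φ κ (quo L x)|
      ≤ (ε * Real.exp (2 * κ₀) + 2 * Φ₀ * Real.exp (3 * κ₀) / N) * Real.exp (-(κ₀ * supNorm (quo N (quo L x) - y₀))) := by
  subst hN'
  have hL : 0 < L := Nat.pos_of_ne_zero (NeZero.ne L)
  have hNpos : 0 < N := Nat.pos_of_ne_zero (NeZero.ne N)
  have hL0 : (0 : ℝ) < L := by exact_mod_cast hL
  have hN0 : (0 : ℝ) < N := by exact_mod_cast hNpos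
  set c : Site (d + 1) := quo L x with hc
  set E : ℝ := Real.exp (-(κ₀ * supNorm (quo N c - y₀))) with hE
  have hE0 : 0 < E := Real.exp_pos _
  set T' : Form1 (d + 1) ℝ := contourSumAdj N φ' with hT'
  set T : Form1 (d + 1) ℝ := contourSumAdj N φ with hT
  -- (1) `𝒬ᵀ_{LN} = 𝒬ᵀ_L ∘ 𝒬ᵀ_N`
  have hmul : contourSumAdj (L * N) φ' κ x = ∑ t ∈ Finset.range L, T' κ (quo L (x - (t : ℤ) • unitVec κ)) := by
    rw [contourSumAdj_mul L N φ', contourSumAdj_eq]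
  -- (2) the per-label estimate
  have hlab : ∀ t ∈ Finset.range L,
      |T' κ (quo L (x - (t : ℤ) • unitVec κ)) - T κ c| ≤ ((N : ℝ) * ε * Real.exp (2 * κ₀) + 2 * Φ₀ * Real.exp (3 * κ₀)) * E := by
    intro t ht
    have htL : t ≤ L := (Finset.mem_range.mp ht).le
    set ct : Site (d + 1) := quo L (x - (t : ℤ) • unitVec κ) with hct
    -- the label `ct` is `c` or `c − e_κ`; in both cases `‖quo N c − y₀‖ ≤ ‖quo N ct − y₀‖ + 1`
    have hnear : supNorm (quo N c - y₀) ≤ supNorm (quo N ct - y₀) + 1 := by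
      rcases quo_sub_natSmul_unitVec_eq_or htL x κ with h | h
      · rw [hct, h]; linarith
      · rw [hct, h, hc]
        have h1 := supNorm_quo_sub_le_succ (N := N) (Nat.one_le_iff_ne_zero.mpr (NeZero.ne N)) (quo L x) y₀ κ
        simpa only [Nat.cast_one, one_smul] using h1
    -- (2a) the kernel difference at the label `ct`
    have hker : |T' κ ct - T κ ct| ≤ (N : ℝ) * ε * Real.exp (2 * κ₀) * E := by
      rw [hT', hT, contourSumAdj_sub]
      refine (abs_contourSumAdj_le_centre hε hκ y₀ hd κ ct).trans ?_
      rw [hE, mul_assoc ((N : ℝ) * ε), mul_assoc ((N : ℝ) * ε), ← Real.exp_add, ← Real.exp_add]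
      refine mul_le_mul_of_nonneg_left (Real.exp_le_exp.mpr ?_) (by positivity)
      nlinarith [mul_le_mul_of_nonneg_left hnear hκ]
    -- (2b) the label wobble of `T`: zero, or one (F4) step
    have hwob : |T κ ct - T κ c| ≤ 2 * Φ₀ * Real.exp (3 * κ₀) * E := by
      rcases quo_sub_natSmul_unitVec_eq_or htL x κ with h | h
      · rw [hct, h, ← hc, sub_self, abs_zero]; positivity
      · have hu : ct = c - unitVec κ := by rw [hct, h]
        have hF4 := abs_contourSumAdj_add_unitVec_sub_le (N := N) hΦ hκ y₀ hφ κ (c - unitVec κ)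
        rw [sub_add_cancel] at hF4
        rw [hu, abs_sub_comm, hT]
        refine hF4.trans ?_
        have hnear' : supNorm (quo N c - y₀) ≤ supNorm (quo N (c - unitVec κ) - y₀) + 1 := by
          have h1 := supNorm_quo_sub_le_succ (N := N) (Nat.one_le_iff_ne_zero.mpr (NeZero.ne N)) c y₀ κ
          simpa only [Nat.cast_one, one_smul] using h1
        rw [hE, mul_assoc (2 * Φ₀), mul_assoc (2 * Φ₀), ← Real.exp_add, ← Real.exp_add]
        refine mul_le_mul_of_nonneg_left (Real.exp_le_exp.mpr ?_) (by positivity)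
        nlinarith [mul_le_mul_of_nonneg_left hnear' hκ]
    calc |T' κ ct - T κ c| = |(T' κ ct - T κ ct) + (T κ ct - T κ c)| := by ring_nf
      _ ≤ |T' κ ct - T κ ct| + |T κ ct - T κ c| := abs_add_le _ _
      _ ≤ (N : ℝ) * ε * Real.exp (2 * κ₀) * E + 2 * Φ₀ * Real.exp (3 * κ₀) * E := add_le_add hker hwob
      _ = _ := by ring
  -- (3) average over `t < L`
  have hcast : (((L * N : ℕ)) : ℝ) = (L : ℝ) * N := by push_cast; ring
  have e : ((L * N : ℕ) : ℝ)⁻¹ * contourSumAdj (L * N) φ' κ x - ((N : ℕ) : ℝ)⁻¹ * contourSumAdj N φ κ (quo L x)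
      = ((L * N : ℕ) : ℝ)⁻¹ * ∑ t ∈ Finset.range L, (T' κ (quo L (x - (t : ℤ) • unitVec κ)) - T κ c) := by
    rw [hmul, Finset.sum_sub_distrib, Finset.sum_const, Finset.card_range, nsmul_eq_mul, mul_sub, hcast]
    congr 1
    rw [hT, hc]
    field_simp
  rw [e, abs_mul, abs_inv, hcast, abs_of_pos (by positivity : (0 : ℝ) < (L : ℝ) * N)]
  calc ((L : ℝ) * N)⁻¹ * |∑ t ∈ Finset.range L, (T' κ (quo L (x - (t : ℤ) • unitVec κ)) - T κ c)|
      ≤ ((L : ℝ) * N)⁻¹ * ∑ t ∈ Finset.range L, |T' κ (quo L (x - (t : ℤ) • unitVec κ)) - T κ c| :=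
        mul_le_mul_of_nonneg_left (Finset.abs_sum_le_sum_abs _ _) (by positivity)
    _ ≤ ((L : ℝ) * N)⁻¹ * ∑ _t ∈ Finset.range L, ((N : ℝ) * ε * Real.exp (2 * κ₀) + 2 * Φ₀ * Real.exp (3 * κ₀)) * E :=
        mul_le_mul_of_nonneg_left (Finset.sum_le_sum hlab) (by positivity)
    _ = (ε * Real.exp (2 * κ₀) + 2 * Φ₀ * Real.exp (3 * κ₀) / N) * E := by
        rw [Finset.sum_const, Finset.card_range, nsmul_eq_mul]
        field_simp

end Refine

/-! ## §4 `d = 3`: consecutive towers of the contact route, unconditionally -/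

section Three

variable {Lc : ℕ} [NeZero Lc]

/-- **CT-4 (γ) AT THE TENT-FORCE LEVEL, `d = 3`, UNCONDITIONAL** (`Lc ≥ 2`): with the unit tents `Φ^{(k)}_{μ,z} κ y := (Lc^{k+1})^8·wΦ_{Lc^{k+1}} κ μ (y − z)`
there are `A, B, δ, θ` with `0 < δ`, `0 ≤ θ < 1` such that for ALL levels `k`, components `μ κ`, source blocks `z` and fine′ sites `x` (tower `k+1`'s fine lattice):
`|(Lc^{k+2})⁻¹·𝒬ᵀ_{Lc^{k+2}}Φ^{(k+1)}_{μ,z} κ x − (Lc^{k+1})⁻¹·𝒬ᵀ_{Lc^{k+1}}Φ^{(k)}_{μ,z} κ (quo Lc x)| ≤ (A·θ^k + B·(Lc^{k+1})⁻¹)·e^{−δ‖quo (Lc^{k+1}) (quo Lc x) − z‖∞}`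
— §3 on my `ContactTentCauchy.exists_unitTent_letters_three` (the K-slot's hK∕hKall read on the mm block). [folklore] -/
theorem exists_tent_refine_three (hLc : 2 ≤ Lc) :
    ∃ A B δ θ : ℝ, 0 < δ ∧ 0 ≤ θ ∧ θ < 1 ∧
      ∀ (k : ℕ) (μ : Fin (3 + 1)) (z : Site (3 + 1)) (κ : Fin (3 + 1)) (x : Site (3 + 1)),
        |(((Lc ^ (k + 1 + 1) : ℕ) : ℝ))⁻¹ *
              contourSumAdj (Lc ^ (k + 1 + 1))
                (fun κ' y => (((Lc : ℝ) ^ (k + 1 + 1)) ^ (2 * (3 + 1))) * wΦ (N := Lc ^ (k + 1 + 1)) (d := 3) κ' μ (y - z)) κ x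
            - (((Lc ^ (k + 1) : ℕ) : ℝ))⁻¹ *
              contourSumAdj (Lc ^ (k + 1))
                (fun κ' y => (((Lc : ℝ) ^ (k + 1)) ^ (2 * (3 + 1))) * wΦ (N := Lc ^ (k + 1)) (d := 3) κ' μ (y - z)) κ (quo Lc x)|
          ≤ (A * θ ^ k + B * (((Lc ^ (k + 1) : ℕ) : ℝ))⁻¹)
              * Real.exp (-(δ * supNorm (quo (Lc ^ (k + 1)) (quo Lc x) - z))) := by
  obtain ⟨C, δ, cK, θ, hδ, hθ0, hθ1, hdec, hcau⟩ := exists_unitTent_letters_three (Lc := Lc) hLc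
  -- nonnegativity of the letters' constants (read off at one point)
  have hC0 : 0 ≤ C := by
    have h := hdec 0 0 0 0 0
    have hpos : 0 < Real.exp (-δ * l1 ((0 : Site (3 + 1)) - 0)) := Real.exp_pos _
    nlinarith [abs_nonneg ((((Lc : ℝ) ^ (0 + 1)) ^ (2 * (3 + 1))) * wΦ (N := Lc ^ (0 + 1)) (d := 3) 0 0 ((0 : Site (3 + 1)) - 0))]
  have hcK0 : 0 ≤ cK := by
    have h := hcau 0 0 0 0 0 0
    rw [sub_self, abs_zero, pow_zero, mul_one] at h
    have hpos : 0 < Real.exp (-δ * l1 ((0 : Site (3 + 1)) - 0)) := Real.exp_pos _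
    nlinarith
  refine ⟨cK * Real.exp (2 * δ), 2 * C * Real.exp (3 * δ), δ, θ, hδ, hθ0, hθ1, fun k μ z κ x => ?_⟩
  -- the two envelopes in ‖·‖∞ currency (ℓ¹ ≥ sup)
  have hwk : ∀ {a : ℝ} (y : Site (3 + 1)), 0 ≤ a → a * Real.exp (-δ * l1 (y - z)) ≤ a * Real.exp (-(δ * supNorm (y - z))) :=
    fun y ha => mul_le_mul_of_nonneg_left (Real.exp_le_exp.mpr (by nlinarith [supNorm_le_l1 (y - z), hδ.le])) ha
  have hφ : ∀ κ' y, |(((Lc : ℝ) ^ (k + 1)) ^ (2 * (3 + 1))) * wΦ (N := Lc ^ (k + 1)) (d := 3) κ' μ (y - z)|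
      ≤ C * Real.exp (-(δ * supNorm (y - z))) := fun κ' y => (hdec k κ' μ y z).trans (hwk y hC0)
  have hd : ∀ κ' y, |(((Lc : ℝ) ^ (k + 1 + 1)) ^ (2 * (3 + 1))) * wΦ (N := Lc ^ (k + 1 + 1)) (d := 3) κ' μ (y - z)
        - (((Lc : ℝ) ^ (k + 1)) ^ (2 * (3 + 1))) * wΦ (N := Lc ^ (k + 1)) (d := 3) κ' μ (y - z)|
      ≤ (cK * θ ^ k) * Real.exp (-(δ * supNorm (y - z))) :=
    fun κ' y => (hcau k 1 κ' μ y z).trans (hwk y (mul_nonneg hcK0 (pow_nonneg hθ0 k)))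
  have key := ntent_refine_sub_le (d := 3) (N := Lc ^ (k + 1)) (L := Lc) (N' := Lc ^ (k + 1 + 1)) (pow_succ' Lc (k + 1))
    hC0 (mul_nonneg hcK0 (pow_nonneg hθ0 k)) hδ.le z hφ hd κ x
  refine key.trans (mul_le_mul_of_nonneg_right (le_of_eq ?_) (Real.exp_pos _).le)
  rw [div_eq_mul_inv]
  push_cast
  ring

/-- **THE SAME AT ALL SCALES** (`d = 3`, `Lc ≥ 2`): tower `k+j` against tower `k`, the fine′ site of tower `k+j` read against its `Lc^j`-cell in tower `k` — ONE
application of §3 with `L = Lc^j` on the ALL-SCALES kernel letter (`hKall` on the mm block), so no summation over intermediate towers is needed: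
`|(Lc^{k+j+1})⁻¹·𝒬ᵀ_{Lc^{k+j+1}}Φ^{(k+j)}_{μ,z} κ x − (Lc^{k+1})⁻¹·𝒬ᵀ_{Lc^{k+1}}Φ^{(k)}_{μ,z} κ (quo (Lc^j) x)| ≤ (A·θ^k + B·(Lc^{k+1})⁻¹)·e^{−δ‖quo (Lc^{k+1}) (quo (Lc^j) x) − z‖∞}`
with the SAME `A, B, δ, θ` for all `k, j`. [folklore] -/
theorem exists_tent_refine_all_three (hLc : 2 ≤ Lc) :
    ∃ A B δ θ : ℝ, 0 < δ ∧ 0 ≤ θ ∧ θ < 1 ∧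
      ∀ (k j : ℕ) (μ : Fin (3 + 1)) (z : Site (3 + 1)) (κ : Fin (3 + 1)) (x : Site (3 + 1)),
        |(((Lc ^ (k + j + 1) : ℕ) : ℝ))⁻¹ *
              contourSumAdj (Lc ^ (k + j + 1))
                (fun κ' y => (((Lc : ℝ) ^ (k + j + 1)) ^ (2 * (3 + 1))) * wΦ (N := Lc ^ (k + j + 1)) (d := 3) κ' μ (y - z)) κ x
            - (((Lc ^ (k + 1) : ℕ) : ℝ))⁻¹ *
              contourSumAdj (Lc ^ (k + 1))
                (fun κ' y => (((Lc : ℝ) ^ (k + 1)) ^ (2 * (3 + 1))) * wΦ (N := Lc ^ (k + 1)) (d := 3) κ' μ (y - z)) κ (quo (Lc ^ j) x)|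
          ≤ (A * θ ^ k + B * (((Lc ^ (k + 1) : ℕ) : ℝ))⁻¹)
              * Real.exp (-(δ * supNorm (quo (Lc ^ (k + 1)) (quo (Lc ^ j) x) - z))) := by
  obtain ⟨C, δ, cK, θ, hδ, hθ0, hθ1, hdec, hcau⟩ := exists_unitTent_letters_three (Lc := Lc) hLc
  have hC0 : 0 ≤ C := by
    have h := hdec 0 0 0 0 0
    have hpos : 0 < Real.exp (-δ * l1 ((0 : Site (3 + 1)) - 0)) := Real.exp_pos _
    nlinarith [abs_nonneg ((((Lc : ℝ) ^ (0 + 1)) ^ (2 * (3 + 1))) * wΦ (N := Lc ^ (0 + 1)) (d := 3) 0 0 ((0 : Site (3 + 1)) - 0))]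
  have hcK0 : 0 ≤ cK := by
    have h := hcau 0 0 0 0 0 0
    rw [sub_self, abs_zero, pow_zero, mul_one] at h
    have hpos : 0 < Real.exp (-δ * l1 ((0 : Site (3 + 1)) - 0)) := Real.exp_pos _
    nlinarith
  haveI : ∀ j : ℕ, NeZero (Lc ^ j) := fun j => ⟨pow_ne_zero _ (NeZero.ne Lc)⟩
  refine ⟨cK * Real.exp (2 * δ), 2 * C * Real.exp (3 * δ), δ, θ, hδ, hθ0, hθ1, fun k j μ z κ x => ?_⟩
  have hwk : ∀ {a : ℝ} (y : Site (3 + 1)), 0 ≤ a → a * Real.exp (-δ * l1 (y - z)) ≤ a * Real.exp (-(δ * supNorm (y - z))) :=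
    fun y ha => mul_le_mul_of_nonneg_left (Real.exp_le_exp.mpr (by nlinarith [supNorm_le_l1 (y - z), hδ.le])) ha
  have hφ : ∀ κ' y, |(((Lc : ℝ) ^ (k + 1)) ^ (2 * (3 + 1))) * wΦ (N := Lc ^ (k + 1)) (d := 3) κ' μ (y - z)|
      ≤ C * Real.exp (-(δ * supNorm (y - z))) := fun κ' y => (hdec k κ' μ y z).trans (hwk y hC0)
  have hd : ∀ κ' y, |(((Lc : ℝ) ^ (k + j + 1)) ^ (2 * (3 + 1))) * wΦ (N := Lc ^ (k + j + 1)) (d := 3) κ' μ (y - z)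
        - (((Lc : ℝ) ^ (k + 1)) ^ (2 * (3 + 1))) * wΦ (N := Lc ^ (k + 1)) (d := 3) κ' μ (y - z)|
      ≤ (cK * θ ^ k) * Real.exp (-(δ * supNorm (y - z))) :=
    fun κ' y => (hcau k j κ' μ y z).trans (hwk y (mul_nonneg hcK0 (pow_nonneg hθ0 k)))
  have hpow : Lc ^ (k + j + 1) = Lc ^ j * Lc ^ (k + 1) := by ring
  have key := ntent_refine_sub_le (d := 3) (N := Lc ^ (k + 1)) (L := Lc ^ j) (N' := Lc ^ (k + j + 1)) hpow
    hC0 (mul_nonneg hcK0 (pow_nonneg hθ0 k)) hδ.le z hφ hd κ x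
  refine key.trans (mul_le_mul_of_nonneg_right (le_of_eq ?_) (Real.exp_pos _).le)
  rw [div_eq_mul_inv]
  push_cast
  ring

end Three

end Summit.QuantumFields.BalabanUV.Beta.GAN24.ContactTentRefine

end
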